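import Literature.MathematicalPhysics.QuantumFieldTheory.Balaban1983to89.B14Eq216Concrete
import Literature.MathematicalPhysics.QuantumFieldTheory.Balaban1983to89.T4Continuum
import Literature.MathematicalPhysics.QuantumFieldTheory.Balaban1983to89.T4ReTrLipUnitary
import HarnessLib

/-!
# Crux `HistoryTailL` (stmt-QuantumFields-19936) — LOCALISATION INTERFACE FOR THE FLUX-LINEAR AVERAGE: the `j`-fold averaged plaquette of a field
# that agrees with a GAUGE COPY of `V` on the feeding fine bonds is the gauge-CONJUGATE of `V`'s averaged plaquette
# (brick (M4a) of the LOCATE «B3» for the capped sweep stub of the ledger skeleton v5 `Cruxes/HistoryTailL/Lines/sandwich_discharge.lean`; text-independent)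

Cell `ym3-torus` (YM ladder rung R3 = continuum SU(2) Yang–Mills on the three-torus; NOT the Clay problem), width seat `ym-ust-19936-w5` gen 13.

THE POINT.  (M1)–(M3) (✓`CovariantDischargeAvgPlaqFluxLinear` p711737, `…Iter`, `…Reading`) are stated in the GLOBAL flat chart `‖W_b − 1‖ ≤ s₀` on every bond.  On the
sandwich event only the plaquettes are small; a consumer gauges `V` on a ball (tree ∕ axial gauge, px8's ARCH-S′ §2) and truncates to a globally small `W`.  This file is
the interface: if `W` agrees with the gauge copy `V^u` on the fine bonds FEEDING the four bonds of `p` (`B14.Eq216Concrete.feeds`), then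
`Ū^{(j)}[W](∂p) = u^{(j)}(p.src) · Ū^{(j)}[V](∂p) · u^{(j)}(p.src)⁻¹` (✓`iter_local` + ✓`T4Continuum.iter_gaugeAct` + ✓`T4ReTrLipUnitary.plaqHol_gaugeAct`), so `dist1` is
unchanged and the `SU(2)` reading rotates covariantly — the choice of gauge is the consumer's, and the geometric inclusion «`feeds` ⊆ the ball» is ALREADY
in the tree by name: ✓`BalabanUVNodesN21ReadSetSupport.feeds_witness` (every source of `feeds j b` lies within `2L^j − 2`, on the cover, of a point of the
`j`-block of `b₋`) and ✓`….src_mem_collar_of_feeds` (collar form `cubeExt s c (w + 4L^j − 3)`), cited not restated.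

WHAT THIS IS NOT.  Bookkeeping over tree theorems; nothing of the capped sweep stub, `HistoryTailL` or the rung is proved.  YM₃ on T³ is rung R3, NOT the Clay problem.

References: T. Bałaban, CMP **98** (1985) 17–51 [Balaban1985Averaging] ((9), (11)–(12) p.19); CMP **119** (1988) 243–285 [Balaban1988Convergent] ((2.11) p.256).
-/

noncomputable section

namespace Summit.QuantumFields.YangMills.Theorems.CovariantDischargeAvgPlaqFluxLocal

open Literature.MathematicalPhysics.QuantumFieldTheory.Balaban1983to89
open Literature.MathematicalPhysics.QuantumFieldTheory.Balaban1983to89.B14.Eq216Concrete (feeds iter_local)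
open Literature.MathematicalPhysics.QuantumFieldTheory.Balaban1983to89.T4Continuum (transfUp iter_gaugeAct)
open Literature.MathematicalPhysics.QuantumFieldTheory.Balaban1983to89.T4ReTrLipUnitary (plaqHol_gaugeAct)

variable {P : Params} {G : Type*} [GaugeGroup G]

/-- ★★ **LOCALISATION INTERFACE**: for any family of one-step averagings `av` (standing range `j ≤ m + K`), any fine fields `W, V`, any finest-lattice gauge transformation
`u`, and any plaquette `p` of `T^{(j)}`: if `W` agrees with the gauge copy `V^u` on the fine bonds feeding the four bonds of `p`, then the `j`-fold averaged plaquette of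
`W` is the conjugate of that of `V` by `u^{(j)}(p.src)`:  `Ū^{(j)}[W](∂p) = u^{(j)}(p.src)·Ū^{(j)}[V](∂p)·u^{(j)}(p.src)⁻¹`.
[cite: Balaban1985Averaging, (11)-(12) p.19; Balaban1988Convergent, (2.11) p.256] -/
theorem plaqHol_iter_eq_conj_of_eqOn_feeds (av : ∀ j, Averaging P j G) {j : ℕ} (hj : j ≤ P.m + P.K) (W V : GaugeField P 0 G)
    (u : GaugeTransf P 0 G) (p : Plaq P j)
    (h₁ : ∀ b₀ ∈ feeds j (⟨p.src, p.μ⟩ : PBond P j), W b₀ = GaugeField.gaugeAct u V b₀)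
    (h₂ : ∀ b₀ ∈ feeds j (⟨p.src.shift p.μ, p.ν⟩ : PBond P j), W b₀ = GaugeField.gaugeAct u V b₀)
    (h₃ : ∀ b₀ ∈ feeds j (⟨p.src.shift p.ν, p.μ⟩ : PBond P j), W b₀ = GaugeField.gaugeAct u V b₀)
    (h₄ : ∀ b₀ ∈ feeds j (⟨p.src, p.ν⟩ : PBond P j), W b₀ = GaugeField.gaugeAct u V b₀) :
    GaugeField.plaqHol (Averaging.iter av j W) p =
      transfUp u j p.src * GaugeField.plaqHol (Averaging.iter av j V) p * (transfUp u j p.src)⁻¹ := by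
  -- the four averaged bonds of `W` are those of the gauge copy
  have e₁ := iter_local av j hj W (GaugeField.gaugeAct u V) ⟨p.src, p.μ⟩ h₁
  have e₂ := iter_local av j hj W (GaugeField.gaugeAct u V) ⟨p.src.shift p.μ, p.ν⟩ h₂
  have e₃ := iter_local av j hj W (GaugeField.gaugeAct u V) ⟨p.src.shift p.ν, p.μ⟩ h₃
  have e₄ := iter_local av j hj W (GaugeField.gaugeAct u V) ⟨p.src, p.ν⟩ h₄
  have hplaq : GaugeField.plaqHol (Averaging.iter av j W) p = GaugeField.plaqHol (Averaging.iter av j (GaugeField.gaugeAct u V)) p := by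
    simp only [GaugeField.plaqHol, e₁, e₂, e₃, e₄]
  rw [hplaq, iter_gaugeAct av u j hj V, plaqHol_gaugeAct]

/-- Consequence: `dist1` of the averaged plaquette is read off the gauge copy (`dist1` is conjugation invariant). [cite: Balaban1985Averaging, (12) p.19] -/
theorem dist1_plaqHol_iter_eq_of_eqOn_feeds (av : ∀ j, Averaging P j G) {j : ℕ} (hj : j ≤ P.m + P.K) (W V : GaugeField P 0 G)
    (u : GaugeTransf P 0 G) (p : Plaq P j)
    (h₁ : ∀ b₀ ∈ feeds j (⟨p.src, p.μ⟩ : PBond P j), W b₀ = GaugeField.gaugeAct u V b₀)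
    (h₂ : ∀ b₀ ∈ feeds j (⟨p.src.shift p.μ, p.ν⟩ : PBond P j), W b₀ = GaugeField.gaugeAct u V b₀)
    (h₃ : ∀ b₀ ∈ feeds j (⟨p.src.shift p.ν, p.μ⟩ : PBond P j), W b₀ = GaugeField.gaugeAct u V b₀)
    (h₄ : ∀ b₀ ∈ feeds j (⟨p.src, p.ν⟩ : PBond P j), W b₀ = GaugeField.gaugeAct u V b₀) :
    GaugeGroup.dist1 (GaugeField.plaqHol (Averaging.iter av j W) p) = GaugeGroup.dist1 (GaugeField.plaqHol (Averaging.iter av j V) p) := by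
  rw [plaqHol_iter_eq_conj_of_eqOn_feeds av hj W V u p h₁ h₂ h₃ h₄, GaugeGroup.dist1_conj]

end Summit.QuantumFields.YangMills.Theorems.CovariantDischargeAvgPlaqFluxLocal

end
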